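/-
Copyright (c) 2026. All rights reserved.
Released under Apache 2.0 license as described in the file LICENSE.
Authors: abc-iut cell, prover seat abc-iut-L5-t12 (gen 14).
-/
import Literature.IUT.LogVolume.MaximalUnramifiedSubfield
import Literature.IUT.LogVolume.DifferentOrdDivisor
import Literature.IUT.LogVolume.RescaledCompletionInvariants
import HarnessLib

/-!
# Ore's bound for number fields: `ord_v(𝔇_{F/ℚ}) ≤ e(v|p) − 1 + e(v|p)·v_p(e(v|p))`

Classical (J.-P. Serre, *Corps locaux*, Ch. III §6 Prop. 13 and the Remark following it, combined with Ch. III §4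
Prop. 10 «the different is preserved by completion»); nothing disputed.  PROOF-ONLY file (no definition, no
instance, no named `Prop` fact).  The sharp local bound `differentOrd p K ≤ 1 − 1/e + v_p(e)` of
`MaximalUnramifiedSubfield.lean` (via the maximal unramified subfield of `K`), read at the rescaled completion
`F_v = RescaledCompletion F p v hv` of a number field `F` at a finite place `v ∣ p` through abc-iut-S1/S7's dictionary
(`differentOrd_rescaledCompletion`: `d_v = ord_v(𝔇_{𝓞F/ℤ})/e(v|p)`, `absRamificationIdx_rescaledCompletion`:
`e(F_v) = e(v|p)`):

* `differentOrd_rescaledCompletion_le_ore` — `d_v ≤ 1 − 1/e(v|p) + v_p(e(v|p))`;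
* **`multiplicity_differentIdeal_le_ore`** — `ord_v(𝔇_{F/ℚ}) ≤ e(v|p) − 1 + e(v|p)·v_p(e(v|p))` (Ore);
* `multiplicity_differentIdeal_lt` — the weaker but handy `ord_v(𝔇_{F/ℚ}) < e(v|p)·(1 + v_p(e(v|p)))`.

PURPOSE: the number-field currency of the wild-different upper bound for the abc-iut R-W window certificates
(GAP-LEDGER G-Wnum2-1 (ii), refuted side).  Nothing here concerns [IUTchIII] Cor. 3.12; no abc claim.
[cite: SerreLocalFields1979, Ch. III §6 Prop. 13 and Remark; Ch. III §4 Prop. 10]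
-/

noncomputable section

open scoped NumberField

namespace Literature.IUT.LogVolume

open NumberField IsDedekindDomain Literature.NumberTheory.NumberFields Literature.NumberTheory.GaloisRepresentations

variable (F : Type) [Field F] [NumberField F] (p : ℕ) [Fact p.Prime]
  (v : HeightOneSpectrum (𝓞 F))

/-- **`d_v ≤ 1 − 1/e(v|p) + v_p(e(v|p))`** for the completion `F_v` of a number field at `v ∣ p` (the sharp local bound
`differentOrd_le_one_sub_inv_add_padicValNat` with `e(F_v) = e(v|p)`).
[cite: SerreLocalFields1979, Ch. III §6 Prop. 13 and Remark] -/
theorem differentOrd_rescaledCompletion_le_ore (hv : ((p : ℕ) : 𝓞 F) ∈ v.asIdeal) :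
    differentOrd p (RescaledCompletion F p v hv) ≤
      1 - 1 / (v.asIdeal.ramificationIdx ℤ : ℝ) + padicValNat p (v.asIdeal.ramificationIdx ℤ) := by
  have h := differentOrd_le_one_sub_inv_add_padicValNat p (RescaledCompletion F p v hv)
  rwa [absRamificationIdx_rescaledCompletion F p v hv] at h

/-- **Ore's bound `ord_v(𝔇_{F/ℚ}) ≤ e(v|p) − 1 + e(v|p)·v_p(e(v|p))`** for the exponent of a finite place `v ∣ p`
in the absolute different of a number field `F` (`= v_{F_v}(𝔇_{F_v/ℚ_p})` by Serre III §4 Prop. 10, bounded by the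
Hensel–Ore bound `e − 1 + v_{F_v}(e)` of Serre III §6 Remark). [cite: SerreLocalFields1979, Ch. III §6 Prop. 13 and Remark; Ch. III §4 Prop. 10] -/
theorem multiplicity_differentIdeal_le_ore (hv : ((p : ℕ) : 𝓞 F) ∈ v.asIdeal) :
    multiplicity v.asIdeal (differentIdeal ℤ (𝓞 F)) ≤
      v.asIdeal.ramificationIdx ℤ - 1 + v.asIdeal.ramificationIdx ℤ * padicValNat p (v.asIdeal.ramificationIdx ℤ) := by
  have h := natCast_mul_differentOrd_le p (RescaledCompletion F p v hv)
  rw [absRamificationIdx_rescaledCompletion F p v hv, differentOrd_rescaledCompletion F p v hv] at h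
  have he : 0 < v.asIdeal.ramificationIdx ℤ := Ideal.ramificationIdx_pos _ _
  have heR : (v.asIdeal.ramificationIdx ℤ : ℝ) ≠ 0 := by exact_mod_cast he.ne'
  rw [mul_div_cancel₀ _ heR] at h
  have h' : (multiplicity v.asIdeal (differentIdeal ℤ (𝓞 F)) : ℝ) ≤
      ((v.asIdeal.ramificationIdx ℤ - 1 + v.asIdeal.ramificationIdx ℤ *
        padicValNat p (v.asIdeal.ramificationIdx ℤ) : ℕ) : ℝ) := by
    push_cast [Nat.cast_sub he]
    exact h
  exact_mod_cast h'

/-- `ord_v(𝔇_{F/ℚ}) < e(v|p)·(1 + v_p(e(v|p)))` (the strict, unsharpened form of Ore's bound).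
[cite: SerreLocalFields1979, Ch. III §6 Prop. 13 and Remark] -/
theorem multiplicity_differentIdeal_lt (hv : ((p : ℕ) : 𝓞 F) ∈ v.asIdeal) :
    multiplicity v.asIdeal (differentIdeal ℤ (𝓞 F)) <
      v.asIdeal.ramificationIdx ℤ * (1 + padicValNat p (v.asIdeal.ramificationIdx ℤ)) := by
  have h := multiplicity_differentIdeal_le_ore F p v hv
  have he : 0 < v.asIdeal.ramificationIdx ℤ := Ideal.ramificationIdx_pos _ _
  have : v.asIdeal.ramificationIdx ℤ - 1 + v.asIdeal.ramificationIdx ℤ * padicValNat p (v.asIdeal.ramificationIdx ℤ)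
      < v.asIdeal.ramificationIdx ℤ * (1 + padicValNat p (v.asIdeal.ramificationIdx ℤ)) := by
    rw [mul_add, mul_one]
    omega
  omega

end Literature.IUT.LogVolume

end
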